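/-
Copyright (c) 2026 the pub-hodgecm-mathlib formalisation cell (harness21).  Prover seat hodgecm-mathlib-K2E5-p12 (g2), HCML Track B «K2-LIT», h413 =
`stmt-HodgeConjecture-24833`, line `K2_E3_EllipticInputs`, unit U3b, sub-line (ii♭-H) «RANK-ONE CAYLEY ROAD», letter (SC₂) — FILE 2 of 4: the index `Q` of the
Cayley dilation on the centraliser of a transvection of `U(σ, J₀)(K)` (rank one).  2026-09-04.
-/
import Summits.HodgeConjecture.HodgeConjecture.Theorems.K2E3RankOneTransvectionNormalForm            -- ★ FILE 1 (this seat, p856070): coordinates, normal form `n(τ)`, centraliser shape, weight algebra, `Ad d(t)`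
import Summits.HodgeConjecture.HodgeConjecture.Theorems.K2E3UnipotentOrbitalScalingTransvectionHaar    -- ★ p855803 (K2E4-p03): `isOpen_isCompact_map_conj`; brings ★ p855757 `subgroupOf_le_and_relIndex_eq_of_conj`, ★ p855558 §1, ★ frame p855528 `coe_mul_measure_preimage_eq_of_relIndex_eq`, ★ `unitaryInt`
import Summits.HodgeConjecture.HodgeConjecture.Theorems.K2E3UnipotentOrbitalScalingRegularIndex        -- ★ p855653-lineage (K2E1b-p01): `mem_map_mulLeft_iff`
import Literature.NumberTheory.Automorphic.UnitaryRankOneBorelModulusIndex                             -- ★ `mem_unitaryInt_iff_forall_v_le_one` (integrality of `g ∈ U(σ, J₀)` is integrality of its entries)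
import HarnessLib

/-!
# h413 ∕ K2-LIT, line `K2_E3_EllipticInputs`, unit U3b, (ii♭-H) (SC₂), FILE 2: THE INDEX `[Z(u₀) ∩ K : Z(u₀) ∩ hKh⁻¹] = Q` FOR EVERY TRANSVECTION OF THE RANK-ONE
# QUASI-SPLIT UNITARY GROUP `M = U(σ, J₀)(K)`

Cell `pub/hodgecm-mathlib`, crux H413 = `stmt-HodgeConjecture-24833`, route of record `HCCMUnconditional`; chair K2-lead (g0), line lead (ii′) K2E4-p06 (g2), dealers
K2E3-plan ∕ K2E5-plan.  THEOREMS ONLY (no `def`, no `instance`, no `notation`, no named-fact hypothesis, no `sorry`); imports = ★ + HarnessLib; lane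
`--supports stmt-HodgeConjecture-24833 --as helper` (count-neutral).  The `N = 2` twin of ★ p855757 ∕ p855803 (K2E4-p03, rung C1 of U3-d) — with NO dyadic
hypothesis: in rank one the centraliser of a transvection is `E¹·{n(b) : σb = −b}` (abelian) and the count is the single lattice index `[𝔤₋(𝒪) : t²𝔤₋(𝒪)] = Q`, valid in
EVERY residue characteristic (the letter carries `2 ≠ 0` only, for the Cayley window).

* §1 (any rank) `mem_centralizer_iff_conj_mem_of_coe_conj` (the `hZ` letter from `mat(h u₀ h⁻¹) = 1 + s•(mat u₀ − 1)`), `map_conj_eq_of_forall_mem_iff`;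
  the valuation-one lemma for `σ`-norm-one elements is ★ `K2E3TransvectionCentralizerLevel.v_eq_one_of_norm_eq_one` (cited).
* §2 (rank one, valued `K`) THE BASE-POINT COUNT `basePoint_data_two`: for `n = n(τ)` (`τ ≠ 0`), `d = d(t)` (`σt = t`, `0 < |t| ≤ 1`), `K₀ = U ∩ GL₂(𝒪)` (★ `unitaryInt`):
  `d` normalises `Z(n)`, `d(Z(n) ∩ K₀)d⁻¹ ≤ Z(n) ∩ K₀`, and `[Z(n) ∩ K₀ : d(Z(n) ∩ K₀)d⁻¹] = [O⁻ : t²O⁻] = Q` — read through the WEIGHT HOMOMORPHISM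
  `Θ : Z(n) →* Multiplicative K`, `z ↦ z₀₁·σz₀₀` (★ FILE 1: additive, skew-valued, of weight `t²` under `Ad d`, onto the skew line at the `n(b)`), Mathlib's
  `Subgroup.relIndex_comap`, and ★ `mem_map_mulLeft_iff`.
* §3 `exists_conj_and_relIndex_of_transvection_two`: (i′) + `hZ` + the count `Q` AT EVERY TRANSVECTION `u₀ ≠ 1` (★ FILE 1 normal form `k u₀ k⁻¹ = n(τ)`, `h := k⁻¹ d k`,
  `K := k⁻¹K₀k`, transport ★ `subgroupOf_le_and_relIndex_eq_of_conj`; (i′) = `mat(h u₀ h⁻¹) = c(t²•X_{u₀})` by ★ `cayley_smul_inverseWindow_of_sub_one_mul_self_eq_zero`).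
* The HAAR HEAD (hypotheses of ★ p855453 §1 with `r = Q`, `a = 1`) is the sequel `K2E3RankOneTransvectionScalingHaar` (the 400-line rule).

HONEST LABEL.  HC_CM is proved only modulo the 7 printed citations (2 remaining named inputs: hLiu418 = `stmt-HodgeConjecture-24832`, h413 =
`stmt-HodgeConjecture-24833`) until rung 0 closes; this file is a count-neutral helper of the U3b (ii♭-H) sub-line.

## References
* [HarishChandra1999AdmissibleDistributions] Harish-Chandra (DeBacker–Sally), *Admissible Invariant Distributions on Reductive p-adic Groups*, ULS 16 (1999), §3.1 Lemma 3.2.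
* [Rogawski1990] J. D. Rogawski, *Automorphic Representations of Unitary Groups in Three Variables* (1990), §3.9 p. 32; §8.1 Prop. 8.1.2 (b) p. 114 (`d(u)`).
* [Weil1982] A. Weil, *Adeles and Algebraic Groups* (1982), Ch. II §2.2 (Haar measures and indices of compact open subgroups).
* [DummitFoote2004] D. S. Dummit, R. M. Foote, *Abstract Algebra*, 3rd ed. (2004), §3.3 (index computations through homomorphisms).
-/

set_option autoImplicit false
set_option linter.dupNamespace false  -- the mandated namespace repeats the single-problem summit's segment (`HodgeConjecture.HodgeConjecture`)

noncomputable section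

open Matrix MeasureTheory
open scoped Matrix MatrixGroups Valued WithZero ENNReal NNReal
open Literature.NumberTheory.Automorphic Literature.NumberTheory.Automorphic.UnitaryGroup Literature.NumberTheory.Automorphic.HermitianLattice
open Literature.NumberTheory.Weil1982.UnitaryFinTopForm
open Summit.HodgeConjecture.HodgeConjecture.Cruxes.H413.K2E3RankOneTransvectionNormalForm
open Summit.HodgeConjecture.HodgeConjecture.Cruxes.H413.K2E3UnipotentOrbitalScalingTransvection
open Summit.HodgeConjecture.HodgeConjecture.Cruxes.H413.K2E3UnipotentOrbitalScalingTransvectionIndex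
open Summit.HodgeConjecture.HodgeConjecture.Cruxes.H413.K2E3UnipotentOrbitalScalingTransvectionHaar
open Summit.HodgeConjecture.HodgeConjecture.Cruxes.H413.K2E3UnipotentAdaptedFrame
open Summit.HodgeConjecture.HodgeConjecture.Cruxes.H413.K2E3UnipotentOrbitalScalingRegularIndex (mem_map_mulLeft_iff)

namespace Summit.HodgeConjecture.HodgeConjecture.Cruxes.H413.K2E3RankOneTransvectionScalingIndex

/-! ## §1 Normalisation of the centraliser (any rank) -/

section Generic

variable {K : Type*} [Field K] (σ : K →+* K) {ι : Type*} [Fintype ι] [DecidableEq ι] {J : Matrix ι ι K}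

/-- **NORMALISATION (any rank)**: if `mat(h u₀ h⁻¹) = 1 + s•(mat u₀ − 1)` with `s ≠ 0` then `z ∈ Z(u₀) ↔ h z h⁻¹ ∈ Z(u₀)` for every `z ∈ U(σ, J)(K)` — the
letter `hZ` of ★ p855453 §1 (`Z(1 + s(u₀ − 1)) = Z(u₀)`, ★ `commute_one_add_smul_sub_one_iff`, and conjugation); the `Fin 3` case is ★ p855558.
[cite: Rogawski1990, §3.9 p. 32] [cite: HarishChandra1999AdmissibleDistributions, §3.1 Lemma 3.2] -/
theorem mem_centralizer_iff_conj_mem_of_coe_conj {s : K} (hs : s ≠ 0) {u₀ h : ↥(unitaryGroupOfForm σ J)}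
    (hconj : (((h * u₀ * h⁻¹ : ↥(unitaryGroupOfForm σ J)) : GL ι K) : Matrix ι ι K) = 1 + s • (((u₀ : GL ι K) : Matrix ι ι K) - 1))
    (z : ↥(unitaryGroupOfForm σ J)) :
    z ∈ Subgroup.centralizer ({u₀} : Set ↥(unitaryGroupOfForm σ J)) ↔ h * z * h⁻¹ ∈ Subgroup.centralizer ({u₀} : Set ↥(unitaryGroupOfForm σ J)) := by
  have hcoe : ∀ x y : ↥(unitaryGroupOfForm σ J), x * y = y * x ↔
      ((x : GL ι K) : Matrix ι ι K) * ((y : GL ι K) : Matrix ι ι K) = ((y : GL ι K) : Matrix ι ι K) * ((x : GL ι K) : Matrix ι ι K) := fun x y => by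
    constructor
    · intro hxy
      have := congrArg (fun w : ↥(unitaryGroupOfForm σ J) => ((w : GL ι K) : Matrix ι ι K)) hxy
      simpa only [Subgroup.coe_mul, Units.val_mul] using this
    · intro hxy
      exact Subtype.ext (Units.ext (by simpa only [Subgroup.coe_mul, Units.val_mul] using hxy))
  rw [Subgroup.mem_centralizer_singleton_iff, Subgroup.mem_centralizer_singleton_iff]
  have key : h * z * h⁻¹ * u₀ = u₀ * (h * z * h⁻¹) ↔ h * z * h⁻¹ * (h * u₀ * h⁻¹) = h * u₀ * h⁻¹ * (h * z * h⁻¹) := by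
    rw [hcoe, hcoe, hconj, commute_one_add_smul_sub_one_iff hs]
  rw [key]
  constructor
  · intro hzu
    calc h * z * h⁻¹ * (h * u₀ * h⁻¹) = h * (z * u₀) * h⁻¹ := by group
      _ = h * (u₀ * z) * h⁻¹ := by rw [hzu]
      _ = h * u₀ * h⁻¹ * (h * z * h⁻¹) := by group
  · intro H
    calc z * u₀ = h⁻¹ * (h * z * h⁻¹ * (h * u₀ * h⁻¹)) * h := by group
      _ = h⁻¹ * (h * u₀ * h⁻¹ * (h * z * h⁻¹)) * h := by rw [H]
      _ = u₀ * z := by group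

end Generic

section Group

variable {G : Type*} [Group G]

/-- If `z ∈ Z ↔ h z h⁻¹ ∈ Z` for all `z` then `hZh⁻¹ = Z` as a `Subgroup.map`. [cite: DummitFoote2004, §3.3] -/
theorem map_conj_eq_of_forall_mem_iff (Z : Subgroup G) (h : G) (hZ : ∀ z : G, z ∈ Z ↔ h * z * h⁻¹ ∈ Z) :
    Z.map (MulAut.conj h).toMonoidHom = Z := by
  ext w
  rw [Subgroup.mem_map]
  constructor
  · rintro ⟨z, hz, rfl⟩
    exact (hZ z).1 hz
  · intro hw
    refine ⟨h⁻¹ * w * h, (hZ _).2 (by rwa [show h * (h⁻¹ * w * h) * h⁻¹ = w by group]), ?_⟩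
    simp only [MulEquiv.coe_toMonoidHom, MulAut.conj_apply]
    group

end Group

/-! ## §2 The base-point count in rank one -/

section Count

variable {K : Type*} [Field K] [Valued K ℤᵐ⁰] (σ : K →+* K)

omit [Valued K ℤᵐ⁰] in
/-- **THE WEIGHT HOMOMORPHISM `Θ : Z(n(τ)) →* Multiplicative K`, `z ↦ z₀₁·σz₀₀`** (`τ ≠ 0`; ★ FILE 1 `weight_mul`: additive on the upper-triangular, norm-one-diagonal
elements that make up `Z(n(τ))`), packaged as an existence statement (no definition is introduced). [cite: Rogawski1990, §3.9 p. 32] -/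
theorem exists_weightHom {n : ↥(unitaryGroupOfForm σ ((StdForm.antidiagonal 2).over K))} {τ : K}
    (hn : ((n : GL (Fin 2) K) : Matrix (Fin 2) (Fin 2) K) = !![1, τ; 0, 1]) (hτ : τ ≠ 0) :
    ∃ Θ : ↥(Subgroup.centralizer ({n} : Set ↥(unitaryGroupOfForm σ ((StdForm.antidiagonal 2).over K)))) →* Multiplicative K,
      ∀ z, (Θ z).toAdd = (((z : ↥(unitaryGroupOfForm σ ((StdForm.antidiagonal 2).over K))) : GL (Fin 2) K) : Matrix (Fin 2) (Fin 2) K) 0 1 *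
        σ ((((z : ↥(unitaryGroupOfForm σ ((StdForm.antidiagonal 2).over K))) : GL (Fin 2) K) : Matrix (Fin 2) (Fin 2) K) 0 0) := by
  refine ⟨MonoidHom.mk' (fun z => Multiplicative.ofAdd
      ((((z : ↥(unitaryGroupOfForm σ ((StdForm.antidiagonal 2).over K))) : GL (Fin 2) K) : Matrix (Fin 2) (Fin 2) K) 0 1 *
        σ ((((z : ↥(unitaryGroupOfForm σ ((StdForm.antidiagonal 2).over K))) : GL (Fin 2) K) : Matrix (Fin 2) (Fin 2) K) 0 0))) ?_, fun z => rfl⟩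
  intro z z'
  obtain ⟨h10, h11⟩ := (mem_centralizer_iff_of_coe_eq_upper σ hn hτ _).1 z.2
  obtain ⟨h10', h11'⟩ := (mem_centralizer_iff_of_coe_eq_upper σ hn hτ _).1 z'.2
  obtain ⟨hn1, -⟩ := norm_eq_one_of_upper σ (z : ↥(unitaryGroupOfForm σ ((StdForm.antidiagonal 2).over K))).2 h10 h11
  obtain ⟨hn1', -⟩ := norm_eq_one_of_upper σ (z' : ↥(unitaryGroupOfForm σ ((StdForm.antidiagonal 2).over K))).2 h10' h11'
  obtain ⟨hw, -, -⟩ := weight_mul σ _ _ h10 h11 h10' h11' hn1 hn1'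
  rw [← ofAdd_add, ← hw, Subgroup.coe_mul, K2E3RankOneTransvectionNormalForm.coe_mul_coe]

set_option maxHeartbeats 800000 in
/-- **THE BASE-POINT DATA (rank one).**  `M = U(σ, J₀)(K)` (`σ` an isometric involution), `n ∈ M` with `mat n = n(τ)`, `τ ≠ 0`, `d ∈ M` with `mat d = d(t)`,
`σt = t ≠ 0`, `|t| ≤ 1`, `K₀ = U ∩ GL₂(𝒪)`, and `[O⁻ : t²O⁻] = Q` for the skew ball `O⁻ = {σx = −x, |x| ≤ 1}`.  Then `d` normalises `Z(n)`, `d(Z(n) ∩ K₀)d⁻¹ ≤ Z(n) ∩ K₀`,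
and `[Z(n) ∩ K₀ : d(Z(n) ∩ K₀)d⁻¹] = Q`.  PROOF through the weight `Θ : Z(n) →* Multiplicative K` (§2): `Z(n) ∩ K₀ = Θ⁻¹(O⁻)`, `d(Z(n) ∩ K₀)d⁻¹ = Θ⁻¹(t²O⁻)`
(`Θ(d⁻¹wd) = t⁻²Θ(w)`), `O⁻ ⊆ Θ(Z(n))` (at `n(b)`), so the index is `[O⁻ : t²O⁻]` (Mathlib `Subgroup.relIndex_comap`).  HC's `d(u) = 2` for the regular class of
`U(1,1)`: one factor `Q`. [cite: HarishChandra1999AdmissibleDistributions, §3.1 Lemma 3.2] [cite: Rogawski1990, §8.1 Prop. 8.1.2 (b) p. 114] [cite: DummitFoote2004, §3.3] -/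
theorem basePoint_data_two (hσ : ∀ a : K, σ (σ a) = a) (hσv : ∀ a : K, Valued.v (σ a) = Valued.v a) {τ : K} (hτ : τ ≠ 0) {t : K} (ht : t ≠ 0)
    (hσt : σ t = t) (hvt : Valued.v t ≤ 1)
    {n d : ↥(unitaryGroupOfForm σ ((StdForm.antidiagonal 2).over K))}
    (hn : ((n : GL (Fin 2) K) : Matrix (Fin 2) (Fin 2) K) = !![1, τ; 0, 1])
    (hd : ((d : GL (Fin 2) K) : Matrix (Fin 2) (Fin 2) K) = Matrix.diagonal ![t, (σ t)⁻¹])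
    (hd' : ((((d : GL (Fin 2) K))⁻¹ : GL (Fin 2) K) : Matrix (Fin 2) (Fin 2) K) = Matrix.diagonal ![t⁻¹, σ t])
    {Om : AddSubgroup K} (hOm : ∀ x : K, x ∈ Om ↔ σ x = -x ∧ Valued.v x ≤ 1)
    {Q : ℕ} (hFm : (Om.map (AddMonoidHom.mulLeft (t * t))).relIndex Om = Q) :
    (Subgroup.centralizer ({n} : Set ↥(unitaryGroupOfForm σ ((StdForm.antidiagonal 2).over K)))).map (MulAut.conj d).toMonoidHom =
        Subgroup.centralizer ({n} : Set ↥(unitaryGroupOfForm σ ((StdForm.antidiagonal 2).over K))) ∧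
      (Subgroup.centralizer ({n} : Set ↥(unitaryGroupOfForm σ ((StdForm.antidiagonal 2).over K))) ⊓ unitaryInt σ ((StdForm.antidiagonal 2).over K)).map
          (MulAut.conj d).toMonoidHom ≤
        Subgroup.centralizer ({n} : Set ↥(unitaryGroupOfForm σ ((StdForm.antidiagonal 2).over K))) ⊓ unitaryInt σ ((StdForm.antidiagonal 2).over K) ∧
      ((Subgroup.centralizer ({n} : Set ↥(unitaryGroupOfForm σ ((StdForm.antidiagonal 2).over K))) ⊓ unitaryInt σ ((StdForm.antidiagonal 2).over K)).map
          (MulAut.conj d).toMonoidHom).relIndex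
        (Subgroup.centralizer ({n} : Set ↥(unitaryGroupOfForm σ ((StdForm.antidiagonal 2).over K))) ⊓ unitaryInt σ ((StdForm.antidiagonal 2).over K)) = Q := by
  classical
  set Zn : Subgroup ↥(unitaryGroupOfForm σ ((StdForm.antidiagonal 2).over K)) :=
    Subgroup.centralizer ({n} : Set ↥(unitaryGroupOfForm σ ((StdForm.antidiagonal 2).over K))) with hZn
  set K₀ : Subgroup ↥(unitaryGroupOfForm σ ((StdForm.antidiagonal 2).over K)) := unitaryInt σ ((StdForm.antidiagonal 2).over K) with hK₀
  have htt : t * t ≠ 0 := mul_ne_zero ht ht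
  have hti : t⁻¹ ≠ 0 := inv_ne_zero ht
  have hσti : σ t⁻¹ = t⁻¹ := by rw [map_inv₀, hσt]
  -- ### `d n d⁻¹ = n(t²τ) = 1 + t²(n − 1)`: `d` normalises `Z(n)`
  have hdn : (((d * n * d⁻¹ : ↥(unitaryGroupOfForm σ ((StdForm.antidiagonal 2).over K))) : GL (Fin 2) K) : Matrix (Fin 2) (Fin 2) K) = !![1, t * t * τ; 0, 1] := by
    have e := coe_torusEltTwo_conj_lineUnipotent σ ht hd hd' hn
    rw [hσt] at e
    simpa only [Subgroup.coe_mul, Subgroup.coe_inv] using e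
  have hconj : (((d * n * d⁻¹ : ↥(unitaryGroupOfForm σ ((StdForm.antidiagonal 2).over K))) : GL (Fin 2) K) : Matrix (Fin 2) (Fin 2) K) =
      1 + (t * t) • (((n : GL (Fin 2) K) : Matrix (Fin 2) (Fin 2) K) - 1) := by
    rw [hdn, hn, one_add_smul_upper_sub_one]
  have hZ : ∀ z, z ∈ Zn ↔ d * z * d⁻¹ ∈ Zn := mem_centralizer_iff_conj_mem_of_coe_conj σ htt hconj
  have hZnd : Zn.map (MulAut.conj d).toMonoidHom = Zn := map_conj_eq_of_forall_mem_iff Zn d hZ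
  -- ### the shape of the elements of `Z(n)`: `!![a, b; 0, a]`, `σa·a = 1`, `|a| = 1`, `θ = b·σa` skew with `|θ| = |b|`
  have hshape : ∀ z : ↥(unitaryGroupOfForm σ ((StdForm.antidiagonal 2).over K)), z ∈ Zn →
      ((z : GL (Fin 2) K) : Matrix (Fin 2) (Fin 2) K) 1 0 = 0 ∧ ((z : GL (Fin 2) K) : Matrix (Fin 2) (Fin 2) K) 1 1 = ((z : GL (Fin 2) K) : Matrix (Fin 2) (Fin 2) K) 0 0 ∧
      σ (((z : GL (Fin 2) K) : Matrix (Fin 2) (Fin 2) K) 0 0) * ((z : GL (Fin 2) K) : Matrix (Fin 2) (Fin 2) K) 0 0 = 1 ∧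
      Valued.v (((z : GL (Fin 2) K) : Matrix (Fin 2) (Fin 2) K) 0 0) = 1 ∧
      σ (((z : GL (Fin 2) K) : Matrix (Fin 2) (Fin 2) K) 0 1 * σ (((z : GL (Fin 2) K) : Matrix (Fin 2) (Fin 2) K) 0 0)) =
        -(((z : GL (Fin 2) K) : Matrix (Fin 2) (Fin 2) K) 0 1 * σ (((z : GL (Fin 2) K) : Matrix (Fin 2) (Fin 2) K) 0 0)) ∧
      Valued.v (((z : GL (Fin 2) K) : Matrix (Fin 2) (Fin 2) K) 0 1 * σ (((z : GL (Fin 2) K) : Matrix (Fin 2) (Fin 2) K) 0 0)) =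
        Valued.v (((z : GL (Fin 2) K) : Matrix (Fin 2) (Fin 2) K) 0 1) := by
    intro z hz
    obtain ⟨h10, h11⟩ := (mem_centralizer_iff_of_coe_eq_upper σ hn hτ z).1 hz
    obtain ⟨hn1, hrel⟩ := norm_eq_one_of_upper σ z.2 h10 h11
    have hva : Valued.v (((z : GL (Fin 2) K) : Matrix (Fin 2) (Fin 2) K) 0 0) = 1 := K2E3TransvectionCentralizerLevel.v_eq_one_of_norm_eq_one σ hσv hn1
    exact ⟨h10, h11, hn1, hva, weight_skew σ hσ hrel, by rw [map_mul, hσv, hva, mul_one]⟩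
  -- ### integrality of `z ∈ Z(n)` is integrality of its weight
  have hint : ∀ z : ↥(unitaryGroupOfForm σ ((StdForm.antidiagonal 2).over K)), z ∈ Zn →
      (z ∈ K₀ ↔ Valued.v (((z : GL (Fin 2) K) : Matrix (Fin 2) (Fin 2) K) 0 1 * σ (((z : GL (Fin 2) K) : Matrix (Fin 2) (Fin 2) K) 0 0)) ≤ 1) := by
    intro z hz
    obtain ⟨h10, h11, -, hva, -, hvθ⟩ := hshape z hz
    rw [hvθ, hK₀, mem_unitaryInt_iff_forall_v_le_one hσv]
    constructor
    · intro h; exact h 0 1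
    · intro h i j
      fin_cases i <;> fin_cases j
      · exact hva.le
      · exact h
      · simp [h10]
      · simp only [Fin.mk_one, Fin.isValue]; rw [h11]; exact hva.le
  -- ### the weight of a `d⁻¹`-conjugate: `θ(d⁻¹ w d) = t⁻²·θ(w)`
  have hdinv : ((((d⁻¹ : ↥(unitaryGroupOfForm σ ((StdForm.antidiagonal 2).over K))) : GL (Fin 2) K)) : Matrix (Fin 2) (Fin 2) K) =
      Matrix.diagonal ![t⁻¹, (σ t⁻¹)⁻¹] := by
    rw [Subgroup.coe_inv, hd', hσti, inv_inv, hσt]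
  have hdinv' : (((((d⁻¹ : ↥(unitaryGroupOfForm σ ((StdForm.antidiagonal 2).over K))) : GL (Fin 2) K))⁻¹ : GL (Fin 2) K) : Matrix (Fin 2) (Fin 2) K) =
      Matrix.diagonal ![t⁻¹⁻¹, σ t⁻¹] := by
    rw [Subgroup.coe_inv, inv_inv, hd, hσti, inv_inv, hσt]
  have hwconj : ∀ w : ↥(unitaryGroupOfForm σ ((StdForm.antidiagonal 2).over K)), w ∈ Zn →
      ((((d⁻¹ * w * d : ↥(unitaryGroupOfForm σ ((StdForm.antidiagonal 2).over K))) : GL (Fin 2) K) : Matrix (Fin 2) (Fin 2) K)) 0 1 *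
          σ (((((d⁻¹ * w * d : ↥(unitaryGroupOfForm σ ((StdForm.antidiagonal 2).over K))) : GL (Fin 2) K) : Matrix (Fin 2) (Fin 2) K)) 0 0) =
        (t * t)⁻¹ * ((((w : GL (Fin 2) K) : Matrix (Fin 2) (Fin 2) K)) 0 1 * σ ((((w : GL (Fin 2) K) : Matrix (Fin 2) (Fin 2) K)) 0 0)) := by
    intro w hw
    obtain ⟨h10, h11, -, -, -, -⟩ := hshape w hw
    have hwmat := eq_upper_of_entries (((w : GL (Fin 2) K) : Matrix (Fin 2) (Fin 2) K)) h10 h11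
    have e : ((((d⁻¹ * w * d : ↥(unitaryGroupOfForm σ ((StdForm.antidiagonal 2).over K))) : GL (Fin 2) K) : Matrix (Fin 2) (Fin 2) K)) =
        !![(((w : GL (Fin 2) K) : Matrix (Fin 2) (Fin 2) K)) 0 0, t⁻¹ * t⁻¹ * (((w : GL (Fin 2) K) : Matrix (Fin 2) (Fin 2) K)) 0 1; 0,
          (((w : GL (Fin 2) K) : Matrix (Fin 2) (Fin 2) K)) 0 0] := by
      have e' := coe_torusEltTwo_conj_upper σ hti hσti hdinv hdinv' hwmat
      rw [show (d⁻¹ * w * d : ↥(unitaryGroupOfForm σ ((StdForm.antidiagonal 2).over K))) = d⁻¹ * w * d⁻¹⁻¹ by rw [inv_inv]]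
      simpa only [Subgroup.coe_mul, Subgroup.coe_inv] using e'
    rw [e]
    simp only [of_apply, cons_val', cons_val_zero, cons_val_one, cons_val_fin_one]
    rw [mul_inv]
    ring
  -- ### membership in `Z(n) ∩ K₀` and in `d(Z(n) ∩ K₀)d⁻¹`, read through the weight
  have hmemD : ∀ z : ↥(unitaryGroupOfForm σ ((StdForm.antidiagonal 2).over K)), z ∈ Zn →
      (z ∈ Zn ⊓ K₀ ↔ (((z : GL (Fin 2) K) : Matrix (Fin 2) (Fin 2) K) 0 1 * σ (((z : GL (Fin 2) K) : Matrix (Fin 2) (Fin 2) K) 0 0)) ∈ Om) := by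
    intro z hz
    obtain ⟨-, -, -, -, hskew, -⟩ := hshape z hz
    rw [Subgroup.mem_inf, and_iff_right hz, hint z hz, hOm, and_iff_right hskew]
  have hmemD' : ∀ w : ↥(unitaryGroupOfForm σ ((StdForm.antidiagonal 2).over K)), w ∈ Zn →
      (w ∈ (Zn ⊓ K₀).map (MulAut.conj d).toMonoidHom ↔
        (((w : GL (Fin 2) K) : Matrix (Fin 2) (Fin 2) K) 0 1 * σ (((w : GL (Fin 2) K) : Matrix (Fin 2) (Fin 2) K) 0 0)) ∈ Om.map (AddMonoidHom.mulLeft (t * t))) := by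
    intro w hw
    have hw' : d⁻¹ * w * d ∈ Zn := (hZ _).2 (by rwa [show d * (d⁻¹ * w * d) * d⁻¹ = w by group])
    rw [Subgroup.mem_map_equiv, MulAut.conj_symm_apply, hmemD _ hw', hwconj w hw, mem_map_mulLeft_iff htt]
  -- ### (hle)
  have hle : (Zn ⊓ K₀).map (MulAut.conj d).toMonoidHom ≤ Zn ⊓ K₀ := by
    intro w hw
    have hwZ : w ∈ Zn := by
      rw [← hZnd]
      exact Subgroup.map_mono inf_le_left hw
    rw [hmemD w hwZ]
    have hθ := (hmemD' w hwZ).1 hw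
    rw [mem_map_mulLeft_iff htt, hOm] at hθ
    obtain ⟨-, -, -, -, hskew, -⟩ := hshape w hwZ
    rw [hOm]
    refine ⟨hskew, ?_⟩
    have hv := hθ.2
    rw [map_mul, map_inv₀, map_mul] at hv
    have hvt1 : Valued.v t * Valued.v t ≤ 1 := mul_le_one' hvt hvt
    have hvt0 : Valued.v t * Valued.v t ≠ 0 := mul_ne_zero ((Valuation.ne_zero_iff _).2 ht) ((Valuation.ne_zero_iff _).2 ht)
    calc Valued.v ((((w : GL (Fin 2) K) : Matrix (Fin 2) (Fin 2) K)) 0 1 * σ ((((w : GL (Fin 2) K) : Matrix (Fin 2) (Fin 2) K)) 0 0))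
        = (Valued.v t * Valued.v t) * ((Valued.v t * Valued.v t)⁻¹ *
            Valued.v ((((w : GL (Fin 2) K) : Matrix (Fin 2) (Fin 2) K)) 0 1 * σ ((((w : GL (Fin 2) K) : Matrix (Fin 2) (Fin 2) K)) 0 0))) := by
          rw [← mul_assoc, mul_inv_cancel₀ hvt0, one_mul]
      _ ≤ 1 * 1 := mul_le_mul' hvt1 hv
      _ = 1 := one_mul 1
  refine ⟨hZnd, hle, ?_⟩
  -- ### the count through `Θ`
  obtain ⟨Θ, hΘ⟩ := exists_weightHom σ hn hτ
  have hA : (Zn ⊓ K₀).subgroupOf Zn = (AddSubgroup.toSubgroup Om).comap Θ := by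
    ext z
    rw [Subgroup.mem_subgroupOf, Subgroup.mem_comap, Multiplicative.mem_toSubgroup, hΘ z]
    exact hmemD z z.2
  have hB : ((Zn ⊓ K₀).map (MulAut.conj d).toMonoidHom).subgroupOf Zn = (AddSubgroup.toSubgroup (Om.map (AddMonoidHom.mulLeft (t * t)))).comap Θ := by
    ext w
    rw [Subgroup.mem_subgroupOf, Subgroup.mem_comap, Multiplicative.mem_toSubgroup, hΘ w]
    exact hmemD' w w.2
  -- `O⁻ ⊆ Θ(Z(n))`: the skew `b` is the weight of `n(b) ∈ Z(n)`
  have hrange : AddSubgroup.toSubgroup Om ≤ Θ.range := by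
    intro x hx
    rw [Multiplicative.mem_toSubgroup, hOm] at hx
    obtain ⟨u, hu, -⟩ := exists_units_coe_eq_lineUnipotent (K := K) x.toAdd
    have huU : u ∈ unitaryGroupOfForm σ ((StdForm.antidiagonal 2).over K) :=
      (mem_unitaryGroupOfForm_iff_of_coe_eq_lineUnipotent σ hu).2 (by rw [hx.1, neg_add_cancel])
    have huZ : (⟨u, huU⟩ : ↥(unitaryGroupOfForm σ ((StdForm.antidiagonal 2).over K))) ∈ Zn :=
      (mem_centralizer_iff_of_coe_eq_upper σ hn hτ _).2 ⟨by simp [hu], by simp [hu]⟩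
    refine ⟨⟨⟨u, huU⟩, huZ⟩, ?_⟩
    apply Multiplicative.toAdd.injective
    rw [hΘ]
    simp [hu]
  rw [← Subgroup.relIndex_subgroupOf (inf_le_left : Zn ⊓ K₀ ≤ Zn), hB, hA, Subgroup.relIndex_comap, Subgroup.map_comap_eq, inf_eq_right.2 hrange,
    AddSubgroup.relIndex_toSubgroup, hFm]

end Count

/-! ## §3 (i′) + `hZ` + the count `Q` at every transvection `u₀ ≠ 1` -/

section Every

variable {K : Type*} [Field K] [Valued K ℤᵐ⁰] (σ : K →+* K)

set_option maxHeartbeats 800000 in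
/-- **(i′) + THE INDEX `Q` AT EVERY TRANSVECTION `u₀ ≠ 1` OF `M = U(σ, J₀)(K)`, rank one** (`σ` an isometric involution, `2 ≠ 0`, `σt = t ≠ 0`, `|t| ≤ 1`; `K₀ = U ∩ GL₂(𝒪)`;
`hOm hFm` the index letter `[O⁻ : t²O⁻] = Q`): there are `h, k ∈ M` with `mat(h u₀ h⁻¹) = c((t·t) • X_{u₀})`, `∀ z, z ∈ Z(u₀) ↔ h z h⁻¹ ∈ Z(u₀)`, and, for
`K := k⁻¹K₀k`, `(K.map (conj h)) ∩ Z(u₀) ≤ K ∩ Z(u₀)` of relative index `Q` inside `Z(u₀)` — §2 at the base point `n(τ) = k u₀ k⁻¹` (★ FILE 1) transported by ★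
`subgroupOf_le_and_relIndex_eq_of_conj` with `h = k⁻¹ d(t) k`. [cite: Rogawski1990, §3.9 p. 32; §8.1 Prop. 8.1.2 (b) p. 114]
[cite: HarishChandra1999AdmissibleDistributions, §3.1 Lemma 3.2] -/
theorem exists_conj_and_relIndex_of_transvection_two (hσ : ∀ a : K, σ (σ a) = a) (hσv : ∀ a : K, Valued.v (σ a) = Valued.v a) (h2 : (2 : K) ≠ 0)
    {t : K} (ht : t ≠ 0) (hσt : σ t = t) (hvt : Valued.v t ≤ 1)
    {Om : AddSubgroup K} (hOm : ∀ x : K, x ∈ Om ↔ σ x = -x ∧ Valued.v x ≤ 1)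
    {Q : ℕ} (hFm : (Om.map (AddMonoidHom.mulLeft (t * t))).relIndex Om = Q)
    (u₀ : ↥(unitaryGroupOfForm σ ((StdForm.antidiagonal 2).over K)))
    (hsq : (((u₀ : GL (Fin 2) K) : Matrix (Fin 2) (Fin 2) K) - 1) * (((u₀ : GL (Fin 2) K) : Matrix (Fin 2) (Fin 2) K) - 1) = 0)
    (hne : ((u₀ : GL (Fin 2) K) : Matrix (Fin 2) (Fin 2) K) ≠ 1) :
    ∃ h k : ↥(unitaryGroupOfForm σ ((StdForm.antidiagonal 2).over K)),
      (((h * u₀ * h⁻¹ : ↥(unitaryGroupOfForm σ ((StdForm.antidiagonal 2).over K))) : GL (Fin 2) K) : Matrix (Fin 2) (Fin 2) K) =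
          cayley ((t * t) • ((((u₀ : GL (Fin 2) K) : Matrix (Fin 2) (Fin 2) K) - 1) * (((u₀ : GL (Fin 2) K) : Matrix (Fin 2) (Fin 2) K) + 1)⁻¹)) ∧
      (∀ z : ↥(unitaryGroupOfForm σ ((StdForm.antidiagonal 2).over K)),
        z ∈ Subgroup.centralizer ({u₀} : Set ↥(unitaryGroupOfForm σ ((StdForm.antidiagonal 2).over K))) ↔
          h * z * h⁻¹ ∈ Subgroup.centralizer ({u₀} : Set ↥(unitaryGroupOfForm σ ((StdForm.antidiagonal 2).over K)))) ∧
      (((unitaryInt σ ((StdForm.antidiagonal 2).over K)).map (MulAut.conj k⁻¹).toMonoidHom).map (MulAut.conj h).toMonoidHom).subgroupOf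
          (Subgroup.centralizer ({u₀} : Set ↥(unitaryGroupOfForm σ ((StdForm.antidiagonal 2).over K)))) ≤
        ((unitaryInt σ ((StdForm.antidiagonal 2).over K)).map (MulAut.conj k⁻¹).toMonoidHom).subgroupOf
          (Subgroup.centralizer ({u₀} : Set ↥(unitaryGroupOfForm σ ((StdForm.antidiagonal 2).over K)))) ∧
      ((((unitaryInt σ ((StdForm.antidiagonal 2).over K)).map (MulAut.conj k⁻¹).toMonoidHom).map (MulAut.conj h).toMonoidHom).subgroupOf
          (Subgroup.centralizer ({u₀} : Set ↥(unitaryGroupOfForm σ ((StdForm.antidiagonal 2).over K))))).relIndex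
        (((unitaryInt σ ((StdForm.antidiagonal 2).over K)).map (MulAut.conj k⁻¹).toMonoidHom).subgroupOf
          (Subgroup.centralizer ({u₀} : Set ↥(unitaryGroupOfForm σ ((StdForm.antidiagonal 2).over K))))) = Q := by
  -- the adapted unitary `k ∈ M`, the normal form `n(τ)` (`τ ≠ 0`), the torus element `d = d(t) ∈ M`, `h := k⁻¹ d k`
  obtain ⟨k₀, hk₀, τ, hτ, -, hkn₀⟩ := exists_conj_coe_eq_upper_of_sq_eq_zero σ hσ u₀.2 hsq hne
  obtain ⟨k, hk⟩ : ∃ k : ↥(unitaryGroupOfForm σ ((StdForm.antidiagonal 2).over K)), (k : GL (Fin 2) K) = k₀ := ⟨⟨k₀, hk₀⟩, rfl⟩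
  obtain ⟨d₀, hd₀, hd₀'⟩ := exists_units_coe_eq_torusEltTwo σ ht
  have hdU : d₀ ∈ unitaryGroupOfForm σ ((StdForm.antidiagonal 2).over K) := torusEltTwo_mem_unitaryGroupOfForm σ ht (by rw [hσt, hσt]) hd₀
  obtain ⟨d, hdk⟩ : ∃ d : ↥(unitaryGroupOfForm σ ((StdForm.antidiagonal 2).over K)), (d : GL (Fin 2) K) = d₀ := ⟨⟨d₀, hdU⟩, rfl⟩
  have hd : ((d : GL (Fin 2) K) : Matrix (Fin 2) (Fin 2) K) = Matrix.diagonal ![t, (σ t)⁻¹] := by rw [hdk]; exact hd₀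
  have hd' : ((((d : GL (Fin 2) K))⁻¹ : GL (Fin 2) K) : Matrix (Fin 2) (Fin 2) K) = Matrix.diagonal ![t⁻¹, σ t] := by rw [hdk]; exact hd₀'
  have hkn : (((k * u₀ * k⁻¹ : ↥(unitaryGroupOfForm σ ((StdForm.antidiagonal 2).over K))) : GL (Fin 2) K) : Matrix (Fin 2) (Fin 2) K) = !![1, τ; 0, 1] := by
    rw [Subgroup.coe_mul, Subgroup.coe_mul, Subgroup.coe_inv, hk]; exact hkn₀
  -- (i′): `mat(h u₀ h⁻¹) = 1 + t²(mat u₀ − 1)` for `h = k⁻¹ d k`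
  have hdn : (((d * (k * u₀ * k⁻¹) * d⁻¹ : ↥(unitaryGroupOfForm σ ((StdForm.antidiagonal 2).over K))) : GL (Fin 2) K) : Matrix (Fin 2) (Fin 2) K) =
      !![1, t * t * τ; 0, 1] := by
    have e := coe_torusEltTwo_conj_lineUnipotent σ ht hd hd' hkn
    rw [hσt] at e
    simpa only [Subgroup.coe_mul, Subgroup.coe_inv] using e
  have hkk : ((((k : GL (Fin 2) K))⁻¹ : GL (Fin 2) K) : Matrix (Fin 2) (Fin 2) K) * ((k : GL (Fin 2) K) : Matrix (Fin 2) (Fin 2) K) = 1 := by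
    rw [← Units.val_mul, inv_mul_cancel, Units.val_one]
  have hu₀ : ((u₀ : GL (Fin 2) K) : Matrix (Fin 2) (Fin 2) K) =
      (((k⁻¹ : ↥(unitaryGroupOfForm σ ((StdForm.antidiagonal 2).over K))) : GL (Fin 2) K) : Matrix (Fin 2) (Fin 2) K) * !![1, τ; 0, 1] *
        ((((k⁻¹ : ↥(unitaryGroupOfForm σ ((StdForm.antidiagonal 2).over K))) : GL (Fin 2) K)⁻¹ : GL (Fin 2) K) : Matrix (Fin 2) (Fin 2) K) := by
    rw [← hkn, Subgroup.coe_inv, inv_inv, Subgroup.coe_mul, Subgroup.coe_mul, Subgroup.coe_inv, Units.val_mul, Units.val_mul]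
    simp only [← Matrix.mul_assoc, hkk, Matrix.one_mul]
    rw [Matrix.mul_assoc, hkk, Matrix.mul_one]
  have hconj1 : ((((k⁻¹ * d * k) * u₀ * (k⁻¹ * d * k)⁻¹ : ↥(unitaryGroupOfForm σ ((StdForm.antidiagonal 2).over K))) : GL (Fin 2) K) : Matrix (Fin 2) (Fin 2) K) =
      1 + (t * t) • (((u₀ : GL (Fin 2) K) : Matrix (Fin 2) (Fin 2) K) - 1) := by
    have hgrp : (k⁻¹ * d * k) * u₀ * (k⁻¹ * d * k)⁻¹ = k⁻¹ * (d * (k * u₀ * k⁻¹) * d⁻¹) * k⁻¹⁻¹ := by group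
    rw [hgrp, Subgroup.coe_mul, Subgroup.coe_mul, Subgroup.coe_inv _ k⁻¹, Units.val_mul, Units.val_mul, hdn, hu₀,
      ← conj_one_add_smul_sub_one ((k⁻¹ : ↥(unitaryGroupOfForm σ ((StdForm.antidiagonal 2).over K))) : GL (Fin 2) K) (t * t),
      one_add_smul_upper_sub_one]
  have hZ := mem_centralizer_iff_conj_mem_of_coe_conj σ (mul_ne_zero ht ht) hconj1
  -- the base point and the transport
  obtain ⟨hZnd, hle, hidx⟩ := basePoint_data_two σ hσ hσv hτ ht hσt hvt hkn hd hd' hOm hFm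
  obtain ⟨hle', hidx'⟩ := subgroupOf_le_and_relIndex_eq_of_conj
    (Subgroup.centralizer ({k * u₀ * k⁻¹} : Set ↥(unitaryGroupOfForm σ ((StdForm.antidiagonal 2).over K)))) (unitaryInt σ ((StdForm.antidiagonal 2).over K))
    (k := k) (d := d) (u₀ := u₀) (h := k⁻¹ * d * k) rfl rfl rfl hZnd hle hidx
  exact ⟨k⁻¹ * d * k, k, by rw [hconj1, cayley_smul_inverseWindow_of_sub_one_mul_self_eq_zero h2 _ hsq], hZ, hle', hidx'⟩

end Every

end Summit.HodgeConjecture.HodgeConjecture.Cruxes.H413.K2E3RankOneTransvectionScalingIndex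

end
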